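import Mathlib
import Summits.Schanuel.Schanuel.Theses.RigidCore
import Literature.ModelTheory.ExponentialFields.DefinabilityParams
import Summits.Schanuel.Schanuel.Theorems.RigidCoreMinimalCounterexampleInAclLogSector
import Summits.Schanuel.Schanuel.Theorems.RigidCoreMinimalCounterexampleInAclHitSetArithmeticalRingDef
import Summits.Schanuel.Schanuel.Theorems.RigidCoreMinimalCounterexampleInAclHitSetArithmeticalRepresentability
import Summits.Schanuel.Schanuel.Theorems.RigidCoreMinimalCounterexampleInAclHitSetArithmeticalArithHierarchy

/-!
# S8 REDUCED TO ITS ANALYTIC CORE: a `Σ⁰₃` presentation of the hit pattern makes it ring-definable over `ℤ`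
# (crux stmt-Schanuel-0969 `RigidCore.MinimalCounterexampleInAcl`, line kernel-arithmetic-selection, stub S8)

`--supports stmt-Schanuel-0969`.  The registered stub `stub_corankOne_hitSetArithmetical` (S8) asks that the HIT PATTERN
`H_x = {κ ∈ ℤ^m : (x_k + 2πiκ_k)_{k<m} is the u-part of a mate of x}` of a corank-one first failure `x` be `∅`-definable in the
ring `ℤ`.  By the representability package landed under this stub (…HitSetArithmeticalRingDef / Graphs / Representability /
ArithHierarchy: Gödel–Kleene, every computable subset of `ℤ^k` is ring-definable, and ring-definable sets are closed under number
quantifiers), S8 follows from its ANALYTIC CORE: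

  (S8′)  `H_x` is a `Σ⁰₃` set: there is a computable `R ⊆ ℤ^m × ℤ³` with `κ ∈ H_x ↔ ∃ a ∀ b ∃ c, (κ, a, b, c) ∈ R`.

This file proves the implication (S8′) ⇒ (S8) for every tuple `x` (`hitSet_ringDefinable_of_sigmaThree`, registered helper), via
the general `ringDefinable_sigmaThree_append`: `{κ | ∃ a ∀ b ∃ c, Fin.append κ ![a, b, c] ∈ R}` is ring-definable for computable `R`.

WHY (S8′) IS TRUE BUT NOT YET FORMALISABLE (status note `Cruxes/MinimalCounterexampleInAcl/Lines/kernel_arithmetic_selection.md`,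
§Addendum c12): with `x = (u, w)`, `e^{u_k} = α_k ∈ ℚ̄`, `u` algebraically independent and `P(u, w) = 0` the irreducible additive
relation, `κ ∈ H_x` iff `∃ e` [`e` codes a total fast-Cauchy Gaussian-rational name of some `w'` (Π⁰₂)] ∧ [`P(u + 2πiκ, w') = 0`
(Π⁰₁)] ∧ [`(u + 2πiκ, w')` is ℚ-linearly independent (Π⁰₂: every non-trivial integer combination is non-zero, a Σ⁰₁ fact about a
computable number)] ∧ [`p_j(u + 2πiκ, w', α, e^{w'}) = 0` for the finitely many generators `p_j` of the relation ideal (Π⁰₁)];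
the candidates `w'` are among the finitely many roots of `P(u + 2πiκ, ·) ≢ 0`, each a computable number, and `u_k = log α_k`
(fixed branch), `π`, `exp` are computable (Weihrauch, *Computable Analysis* (2000), Thm 4.3.2, §6.3).  Formalising this needs
computable real/complex numbers, computability of `exp`, of algebraic numbers and of polynomial roots — none of which exists in
Mathlib or in this tree; it is the open remainder of S8.
-/

-- the summit namespace `Summit.Schanuel.Schanuel.…` repeats a component by design (D-0022)
set_option linter.dupNamespace false

open Set FirstOrder FirstOrder.Language

namespace Summit.Schanuel.Schanuel.Cruxes.MinimalCounterexampleInAcl.KernelArithmeticSelection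

open Literature.ModelTheory.ExponentialFields

section RingZ

variable [FirstOrder.Ring.CompatibleRing ℤ] {α : Type*}

/-- Appending three bound integer variables to a tuple is a ring-definable map (each coordinate is a projection). [folklore] -/
theorem ringDefinableMap_append_three {m : ℕ} :
    (∅ : Set ℤ).DefinableMap Language.ring (fun w : ((Fin m ⊕ Unit) ⊕ Unit) ⊕ Unit → ℤ =>
      Fin.append (fun k : Fin m => w (Sum.inl (Sum.inl (Sum.inl k))))
        ![w (Sum.inl (Sum.inl (Sum.inr ()))), w (Sum.inl (Sum.inr ())), w (Sum.inr ())]) := by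
  intro i
  refine Fin.addCases (fun j => ?_) (fun j => ?_) i
  · simp only [Fin.append_left]
    exact definableFun_proj_params _
  · simp only [Fin.append_right]
    fin_cases j
    · simpa using definableFun_proj_params (L := Language.ring) (A := (∅ : Set ℤ)) (Sum.inl (Sum.inl (Sum.inr ())))
    · simpa using definableFun_proj_params (L := Language.ring) (A := (∅ : Set ℤ)) (Sum.inl (Sum.inr ()))
    · simpa using definableFun_proj_params (L := Language.ring) (A := (∅ : Set ℤ)) (Sum.inr ())

/-- **`Σ⁰₃` sets are ring-definable**: for a computable `R ⊆ ℤ^{m+3}`, the set `{κ ∈ ℤ^m | ∃ a ∀ b ∃ c, (κ, a, b, c) ∈ R}` is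
`∅`-definable in the ring `ℤ` (representability `ringDefinable_setOf_computablePred` + quantifier closure). [folklore] -/
theorem ringDefinable_sigmaThree_append {m : ℕ} {R : Set (Fin (m + 3) → ℤ)} (hR : ComputablePred (· ∈ R)) :
    (∅ : Set ℤ).Definable Language.ring
      {κ : Fin m → ℤ | ∃ a : ℤ, ∀ b : ℤ, ∃ c : ℤ, Fin.append κ ![a, b, c] ∈ R} :=
  definable_setOf_exists_params (definable_setOf_forall_params (definable_setOf_exists_params
    (ringDefinable_setOf_substitute (ringDefinable_setOf_computablePred hR) ringDefinableMap_append_three)))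

/-- `Π⁰₃` sets are ring-definable: `{κ | ∀ a ∃ b ∀ c, (κ, a, b, c) ∈ R}` for computable `R ⊆ ℤ^{m+3}`. [folklore] -/
theorem ringDefinable_piThree_append {m : ℕ} {R : Set (Fin (m + 3) → ℤ)} (hR : ComputablePred (· ∈ R)) :
    (∅ : Set ℤ).Definable Language.ring
      {κ : Fin m → ℤ | ∀ a : ℤ, ∃ b : ℤ, ∀ c : ℤ, Fin.append κ ![a, b, c] ∈ R} :=
  definable_setOf_forall_params (definable_setOf_exists_params (definable_setOf_forall_params
    (ringDefinable_setOf_substitute (ringDefinable_setOf_computablePred hR) ringDefinableMap_append_three)))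

/-- Appending four bound integer variables to a tuple is a ring-definable map. [folklore] -/
theorem ringDefinableMap_append_four {m : ℕ} :
    (∅ : Set ℤ).DefinableMap Language.ring (fun w : (((Fin m ⊕ Unit) ⊕ Unit) ⊕ Unit) ⊕ Unit → ℤ =>
      Fin.append (fun k : Fin m => w (Sum.inl (Sum.inl (Sum.inl (Sum.inl k)))))
        ![w (Sum.inl (Sum.inl (Sum.inl (Sum.inr ())))), w (Sum.inl (Sum.inl (Sum.inr ()))), w (Sum.inl (Sum.inr ())),
          w (Sum.inr ())]) := by
  intro i
  refine Fin.addCases (fun j => ?_) (fun j => ?_) i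
  · simp only [Fin.append_left]
    exact definableFun_proj_params _
  · simp only [Fin.append_right]
    fin_cases j
    · simpa using definableFun_proj_params (L := Language.ring) (A := (∅ : Set ℤ))
        (Sum.inl (Sum.inl (Sum.inl (Sum.inr ()))))
    · simpa using definableFun_proj_params (L := Language.ring) (A := (∅ : Set ℤ)) (Sum.inl (Sum.inl (Sum.inr ())))
    · simpa using definableFun_proj_params (L := Language.ring) (A := (∅ : Set ℤ)) (Sum.inl (Sum.inr ()))
    · simpa using definableFun_proj_params (L := Language.ring) (A := (∅ : Set ℤ)) (Sum.inr ())

/-- `Σ⁰₄` sets are ring-definable: `{κ | ∃ a ∀ b ∃ c ∀ d, (κ, a, b, c, d) ∈ R}` for computable `R ⊆ ℤ^{m+4}` (one more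
alternation than the analysis of S8 predicts, for robustness of the reduction). [folklore] -/
theorem ringDefinable_sigmaFour_append {m : ℕ} {R : Set (Fin (m + 4) → ℤ)} (hR : ComputablePred (· ∈ R)) :
    (∅ : Set ℤ).Definable Language.ring
      {κ : Fin m → ℤ | ∃ a : ℤ, ∀ b : ℤ, ∃ c : ℤ, ∀ d : ℤ, Fin.append κ ![a, b, c, d] ∈ R} :=
  definable_setOf_exists_params (definable_setOf_forall_params (definable_setOf_exists_params
    (definable_setOf_forall_params
      (ringDefinable_setOf_substitute (ringDefinable_setOf_computablePred hR) ringDefinableMap_append_four))))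

end RingZ

/-! ## (S8′) ⇒ (S8) -/

/-- Registered helper stub `hitSet_ringDefinable_of_sigmaThree` of crux stmt-Schanuel-0969 (line kernel-arithmetic-selection):
**a `Σ⁰₃` presentation of the hit pattern of a tuple `x ∈ ℂ^{m+1}` by a computable relation makes the hit pattern `∅`-definable
in the ring `ℤ`** — the reduction of S8 (`stub_corankOne_hitSetArithmetical`) to its computable-analysis core (S8′), by
Gödel–Kleene representability (`ringDefinable_of_computablePred_std`) and quantifier closure. [folklore] -/
theorem hitSet_ringDefinable_of_sigmaThree : ∀ (m : ℕ) (x : Fin (m + 1) → ℂ), (∃ R : Set (Fin (m + 3) → ℤ), ComputablePred (fun v : Fin (m + 3) → ℤ => v ∈ R) ∧ ∀ κ : Fin m → ℤ, ((fun k => x (Fin.castSucc k) + 2 * ↑Real.pi * Complex.I * (κ k : ℂ)) ∈ {v : Fin m → ℂ | ∃ x' ∈ Summit.Schanuel.Schanuel.Cruxes.MinimalCounterexampleInAcl.KernelArithmeticSelection.locusMates x, ∀ k, v k = x' (Fin.castSucc k)} ↔ ∃ a : ℤ, ∀ b : ℤ, ∃ c : ℤ, Fin.append κ ![a, b, c]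 ∈ R)) → (letI := FirstOrder.Ring.compatibleRingOfRing ℤ; (∅ : Set ℤ).Definable FirstOrder.Language.ring {κ : Fin m → ℤ | (fun k => x (Fin.castSucc k) + 2 * ↑Real.pi * Complex.I * (κ k : ℂ)) ∈ {v : Fin m → ℂ | ∃ x' ∈ Summit.Schanuel.Schanuel.Cruxes.MinimalCounterexampleInAcl.KernelArithmeticSelection.locusMates x, ∀ k, v k = x' (Fin.castSucc k)}}) := by
  intro m x h
  obtain ⟨R, hR, hiff⟩ := h
  letI := FirstOrder.Ring.compatibleRingOfRing ℤ
  have hdef := ringDefinable_sigmaThree_append hR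
  convert hdef using 1
  ext κ
  simp only [mem_setOf_eq]
  exact hiff κ

/-- The same reduction with the corank-one first-failure hypotheses of S8 displayed (they are not used by the reduction; they
are what makes (S8′) true): under (S8′) the registered statement of `stub_corankOne_hitSetArithmetical` holds for `x`.
[folklore] -/
theorem stub_corankOne_hitSetArithmetical_of_sigmaThree (m : ℕ) (_hm : 2 ≤ m) (x : Fin (m + 1) → ℂ)
    (_hx : x ∈ firstFailures (m + 1)) (_halg : ∀ i : Fin (m + 1), (i : ℕ) < m → IsAlgebraic ℚ (Complex.exp (x i)))
    (_hpure : ∀ M : Fin (m + 1) → ℤ, M (Fin.last m) ≠ 0 → Transcendental ℚ (Complex.exp (∑ i, (M i : ℂ) * x i)))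
    (hS3 : ∃ R : Set (Fin (m + 3) → ℤ), ComputablePred (fun v : Fin (m + 3) → ℤ => v ∈ R) ∧
      ∀ κ : Fin m → ℤ, ((fun k => x (Fin.castSucc k) + 2 * ↑Real.pi * Complex.I * (κ k : ℂ)) ∈
        {v : Fin m → ℂ | ∃ x' ∈ locusMates x, ∀ k, v k = x' (Fin.castSucc k)} ↔
        ∃ a : ℤ, ∀ b : ℤ, ∃ c : ℤ, Fin.append κ ![a, b, c] ∈ R)) :
    (letI := FirstOrder.Ring.compatibleRingOfRing ℤ; (∅ : Set ℤ).Definable FirstOrder.Language.ring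
      {κ : Fin m → ℤ | (fun k => x (Fin.castSucc k) + 2 * ↑Real.pi * Complex.I * (κ k : ℂ)) ∈
        {v : Fin m → ℂ | ∃ x' ∈ locusMates x, ∀ k, v k = x' (Fin.castSucc k)}}) := by
  exact hitSet_ringDefinable_of_sigmaThree m x hS3

/-- `Σ⁰₄` variant of the reduction (one spare alternation): a `Σ⁰₄` presentation of the hit pattern by a computable relation
makes it `∅`-definable in the ring `ℤ`. [folklore] -/
theorem hitSet_ringDefinable_of_sigmaFour (m : ℕ) (x : Fin (m + 1) → ℂ)
    (hS4 : ∃ R : Set (Fin (m + 4) → ℤ), ComputablePred (fun v : Fin (m + 4) → ℤ => v ∈ R) ∧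
      ∀ κ : Fin m → ℤ, ((fun k => x (Fin.castSucc k) + 2 * ↑Real.pi * Complex.I * (κ k : ℂ)) ∈
        {v : Fin m → ℂ | ∃ x' ∈ locusMates x, ∀ k, v k = x' (Fin.castSucc k)} ↔
        ∃ a : ℤ, ∀ b : ℤ, ∃ c : ℤ, ∀ d : ℤ, Fin.append κ ![a, b, c, d] ∈ R)) :
    (letI := FirstOrder.Ring.compatibleRingOfRing ℤ; (∅ : Set ℤ).Definable FirstOrder.Language.ring
      {κ : Fin m → ℤ | (fun k => x (Fin.castSucc k) + 2 * ↑Real.pi * Complex.I * (κ k : ℂ)) ∈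
        {v : Fin m → ℂ | ∃ x' ∈ locusMates x, ∀ k, v k = x' (Fin.castSucc k)}}) := by
  obtain ⟨R, hR, hiff⟩ := hS4
  letI := FirstOrder.Ring.compatibleRingOfRing ℤ
  have hdef := ringDefinable_sigmaFour_append hR
  convert hdef using 1
  ext κ
  simp only [mem_setOf_eq]
  exact hiff κ

end Summit.Schanuel.Schanuel.Cruxes.MinimalCounterexampleInAcl.KernelArithmeticSelection
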